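import Mathlib.Analysis.InnerProductSpace.l2Space
import Mathlib.Analysis.InnerProductSpace.Adjoint
import HarnessLib

/-!
# Hilbert–Schmidt sums: independence of the basis and decomposition along an orthogonal sum
(Reed–Simon I, Thm. II.6, Thm. VI.18 and Thm. VI.22 (b), (d); Gelbart, *Automorphic forms on adele
groups* (1975), Lemma 10.6, (10.12)–(10.14))

Topic `Analysis/OperatorTheory`; theorems only (no definition, no named fact, no instance).
Mathlib has no Hilbert–Schmidt class; as in `IntegralOperatorHilbertSchmidt` the Hilbert–Schmidt
norm of a bounded operator `T : E → F` between Hilbert spaces is handled through the sums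
`Σ_i ‖T e_i‖²` over Hilbert bases `(e_i)`, here as `ℝ≥0∞`-valued `tsum`s of `‖·‖ₑ ^ 2` (always
defined). This file proves the three facts that turn such a sum into a spectral expression:

* `hasSum_norm_inner_sq`, `tsum_enorm_inner_sq` — **Parseval** `Σ_i |⟨e_i, x⟩|² = ‖x‖²`
  (Mathlib's `HilbertBasis.hasSum_inner_mul_inner` in norm-square form).
* `tsum_enorm_sq_apply_eq_tsum_enorm_sq_adjoint_apply` — `Σ_i ‖T e_i‖² = Σ_k ‖T† f_k‖²` for
  *any* Hilbert bases `(e_i)` of `E` and `(f_k)` of `F` (Parseval twice and Tonelli for sums);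
  hence `tsum_enorm_sq_apply_eq_of_hilbertBasis` — **the Hilbert–Schmidt sum does not depend on
  the Hilbert basis** (Reed–Simon I, Thm. VI.18 / VI.22 (b)), and
  `tsum_enorm_sq_conj_apply_eq` — **it is invariant under unitary equivalence**
  `T ↦ U' ∘ T ∘ U⁻¹`.
* `exists_hilbertBasis_sigma` — Hilbert bases `(e^i_k)_k` of pairwise orthogonal complete
  subspaces `V i ≤ E` with dense sum assemble to a Hilbert basis `(e^i_k)_{(i,k)}` of `E`
  (Mathlib `OrthogonalFamily.orthonormal_sigma_orthonormal` with `HilbertBasis.mkOfOrthogonalEqBot`);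
  hence `tsum_enorm_sq_apply_eq_tsum_sigma` — **the Hilbert–Schmidt sum of `T` over any Hilbert
  basis of `E = ⊕̂ᵢ V i` is `Σ_i Σ_k ‖T e^i_k‖²`, the sum of the Hilbert–Schmidt sums of the
  blocks `T|_{V i}`** (Reed–Simon I, Thm. VI.22 (d) in block form).

Why this is here. On the compact quotient `X = D_𝔸ˣ ⧸ ℝ_{>0} Dˣ` the tree has the geometric
expansion of `Σ_i ‖R(f) e_i‖²` for every Hilbert basis of `L²(X)`
(`Literature.NumberTheory.Automorphic.QuaternionUnitsTraceHS`, Gelbart (9.11)–(9.13), (10.14)),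
and `L²(X)` is the orthogonal sum of irreducible closed invariant subspaces `W ∈ S`, each class
occurring `m(σ)` times (`HilbertRepOrthogonalDecomposition`, `QuaternionUnitsSpectrumDiscrete`).
With `V = (W)_{W ∈ S}` the last item rewrites the left-hand side as `Σ_{W ∈ S} ‖R(f)|_W‖²_{HS}`,
and the unitary invariance groups equivalent `W`'s: `Σ_σ m(σ) ‖σ(f)‖²_{HS}` — the spectral side
of Gelbart's (10.12)/(10.14), `tr R'_ψ(f ⋆ f^*) = Σ m(π') tr π'(f) π'(f)^*`, in the form that needs
no trace class. This is a brick of the inline (D-0026) decomposition of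
`Literature.NumberTheory.Automorphic.multiplicity_one_quaternionUnits` /
`strong_multiplicity_one_quaternionUnits` (Gelbart Thm. 10.10, Thm. 10.5 (ii)).

## References

* M. Reed, B. Simon, *Methods of Modern Mathematical Physics I: Functional Analysis* (1972,
  rev. ed. 1980), Thm. II.6 (PDF p. 46), §VI.6 Thm. VI.18 (PDF p. 196), Thm. VI.22 (PDF p. 198)
  of the held copy [ReedSimon1972].
* S. Gelbart, *Automorphic forms on adele groups*, Ann. of Math. Studies 83 (1975), Lemma 10.6,
  (10.12)–(10.14) [Gelbart1975].
-/

noncomputable section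

open scoped InnerProductSpace ENNReal ComplexConjugate
open Filter Topology

namespace Literature.Analysis.OperatorTheory

variable {𝕜 : Type*} [RCLike 𝕜] {E F : Type*}
  [NormedAddCommGroup E] [InnerProductSpace 𝕜 E] [CompleteSpace E]
  [NormedAddCommGroup F] [InnerProductSpace 𝕜 F] [CompleteSpace F]

/-! ### Parseval in norm-square form -/

omit [CompleteSpace E] in
/-- **Parseval's identity, norm-square form**: for a Hilbert basis `(e_i)` of `E` and `x ∈ E`,
`Σ_i |⟨e_i, x⟩|² = ‖x‖²` (Mathlib `HilbertBasis.hasSum_inner_mul_inner` with `y = x`, real parts;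
Reed–Simon I, Thm. II.6). [cite: ReedSimon1972, Thm. II.6] -/
theorem hasSum_norm_inner_sq {ι : Type*} (b : HilbertBasis ι 𝕜 E) (x : E) :
    HasSum (fun i => ‖⟪b i, x⟫_𝕜‖ ^ 2) (‖x‖ ^ 2) := by
  have h := (b.hasSum_inner_mul_inner x x).map RCLike.re RCLike.continuous_re
  rw [← inner_self_eq_norm_sq (𝕜 := 𝕜)]
  convert h using 1
  funext i
  simp only [Function.comp_apply]
  rw [← inner_conj_symm x (b i), RCLike.conj_mul, ← RCLike.ofReal_pow, RCLike.ofReal_re]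

omit [CompleteSpace E] in
/-- Parseval in `ℝ≥0∞`: `Σ_i ‖⟨e_i, x⟩‖ₑ² = ‖x‖ₑ²`. [cite: ReedSimon1972, Thm. II.6] -/
theorem tsum_enorm_inner_sq {ι : Type*} (b : HilbertBasis ι 𝕜 E) (x : E) :
    ∑' i, (‖⟪b i, x⟫_𝕜‖ₑ) ^ 2 = ‖x‖ₑ ^ 2 := by
  have h := hasSum_norm_inner_sq b x
  have h2 : ∀ i, (‖⟪b i, x⟫_𝕜‖ₑ) ^ 2 = ENNReal.ofReal (‖⟪b i, x⟫_𝕜‖ ^ 2) := fun i => by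
    rw [← ofReal_norm, ENNReal.ofReal_pow (norm_nonneg _)]
  simp_rw [h2]
  rw [← ENNReal.ofReal_tsum_of_nonneg (fun i => sq_nonneg _) h.summable, h.tsum_eq,
    ← ofReal_norm, ENNReal.ofReal_pow (norm_nonneg _)]

/-! ### The Hilbert–Schmidt sum through the adjoint; independence of the basis -/

/-- **`Σ_i ‖T e_i‖² = Σ_k ‖T† f_k‖²`** for any Hilbert bases `(e_i)` of `E` and `(f_k)` of `F`
and any bounded `T : E → F` (in `ℝ≥0∞`): expand `‖T e_i‖² = Σ_k |⟨f_k, T e_i⟩|²` (Parseval in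
`F`), note `⟨f_k, T e_i⟩ = ⟨T† f_k, e_i⟩`, interchange the sums (Tonelli) and resum with Parseval
in `E` (Reed–Simon I, proof of Thm. VI.18). [cite: ReedSimon1972, Thm. VI.18 (proof)] -/
theorem tsum_enorm_sq_apply_eq_tsum_enorm_sq_adjoint_apply {ι ι' : Type*}
    (b : HilbertBasis ι 𝕜 E) (c : HilbertBasis ι' 𝕜 F) (T : E →L[𝕜] F) :
    ∑' i, ‖T (b i)‖ₑ ^ 2 = ∑' k, ‖ContinuousLinearMap.adjoint T (c k)‖ₑ ^ 2 := by
  calc ∑' i, ‖T (b i)‖ₑ ^ 2 = ∑' i, ∑' k, (‖⟪c k, T (b i)⟫_𝕜‖ₑ) ^ 2 := by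
        simp_rw [tsum_enorm_inner_sq]
    _ = ∑' k, ∑' i, (‖⟪c k, T (b i)⟫_𝕜‖ₑ) ^ 2 := ENNReal.tsum_comm
    _ = ∑' k, ∑' i, (‖⟪b i, ContinuousLinearMap.adjoint T (c k)⟫_𝕜‖ₑ) ^ 2 := by
        refine tsum_congr fun k => tsum_congr fun i => ?_
        rw [← ContinuousLinearMap.adjoint_inner_left, ← inner_conj_symm, enorm_eq_nnnorm,
          enorm_eq_nnnorm, RCLike.nnnorm_conj]
    _ = ∑' k, ‖ContinuousLinearMap.adjoint T (c k)‖ₑ ^ 2 := by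
        simp_rw [tsum_enorm_inner_sq]

/-- **The Hilbert–Schmidt sum `Σ_i ‖T e_i‖²` does not depend on the Hilbert basis**
(Reed–Simon I, Thm. VI.18 and Thm. VI.22 (b)): both sides equal `Σ_k ‖T† f_k‖²` for a Hilbert
basis `(f_k)` of `F` (Mathlib `exists_hilbertBasis`). [cite: ReedSimon1972, Thm. VI.22] -/
theorem tsum_enorm_sq_apply_eq_of_hilbertBasis {ι ι' : Type*}
    (b : HilbertBasis ι 𝕜 E) (b' : HilbertBasis ι' 𝕜 E) (T : E →L[𝕜] F) :
    ∑' i, ‖T (b i)‖ₑ ^ 2 = ∑' j, ‖T (b' j)‖ₑ ^ 2 := by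
  obtain ⟨w, c, -⟩ := exists_hilbertBasis 𝕜 F
  rw [tsum_enorm_sq_apply_eq_tsum_enorm_sq_adjoint_apply b c T,
    tsum_enorm_sq_apply_eq_tsum_enorm_sq_adjoint_apply b' c T]

/-- **The Hilbert–Schmidt sum of `T†` equals that of `T`** (Reed–Simon I, Thm. VI.22 (c)).
[cite: ReedSimon1972, Thm. VI.22] -/
theorem tsum_enorm_sq_adjoint_apply_eq {ι ι' : Type*}
    (b : HilbertBasis ι 𝕜 E) (c : HilbertBasis ι' 𝕜 F) (T : E →L[𝕜] F) :
    ∑' k, ‖ContinuousLinearMap.adjoint T (c k)‖ₑ ^ 2 = ∑' i, ‖T (b i)‖ₑ ^ 2 :=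
  (tsum_enorm_sq_apply_eq_tsum_enorm_sq_adjoint_apply b c T).symm

/-! ### Unitary invariance -/

section Unitary

variable {E' F' : Type*} [NormedAddCommGroup E'] [InnerProductSpace 𝕜 E'] [CompleteSpace E']
  [NormedAddCommGroup F'] [InnerProductSpace 𝕜 F'] [CompleteSpace F']

omit [CompleteSpace E] [CompleteSpace E'] in
/-- A Hilbert basis transported along a unitary `U : E ≃ E'`: there is a Hilbert basis of `E'`
consisting of the vectors `U e_i` (its `repr` is `U⁻¹` followed by that of `(e_i)`). [folklore] -/
theorem exists_hilbertBasis_map_linearIsometryEquiv {ι : Type*} (b : HilbertBasis ι 𝕜 E)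
    (U : E ≃ₗᵢ[𝕜] E') : ∃ b' : HilbertBasis ι 𝕜 E', ∀ i, b' i = U (b i) := by
  refine ⟨⟨U.symm.trans b.repr⟩, fun i => ?_⟩
  classical
  rw [← HilbertBasis.repr_symm_single (⟨U.symm.trans b.repr⟩ : HilbertBasis ι 𝕜 E') i,
    ← HilbertBasis.repr_symm_single b i]
  change (U.symm.trans b.repr).symm (lp.single 2 i (1 : 𝕜)) = U (b.repr.symm (lp.single 2 i 1))
  rw [LinearIsometryEquiv.symm_trans, LinearIsometryEquiv.trans_apply, LinearIsometryEquiv.symm_symm]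

omit [CompleteSpace E] [CompleteSpace F] in
/-- **Unitary invariance of the Hilbert–Schmidt sum**: for unitaries `U : E ≃ E'`, `U' : F ≃ F'`
and Hilbert bases `(e_i)` of `E`, `(e'_j)` of `E'`,
`Σ_j ‖U' (T (U⁻¹ e'_j))‖² = Σ_i ‖T e_i‖²` — the operator `U' ∘ T ∘ U⁻¹ : E' → F'` has the same
Hilbert–Schmidt sum as `T` (basis independence applied to the basis `(U e_i)` of `E'`; Reed–Simon
I, Thm. VI.22). In particular unitarily equivalent operators have equal Hilbert–Schmidt sums.
[cite: ReedSimon1972, Thm. VI.22] -/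
theorem tsum_enorm_sq_conj_apply_eq {ι ι' : Type*} (b : HilbertBasis ι 𝕜 E)
    (b' : HilbertBasis ι' 𝕜 E') (T : E →L[𝕜] F) (U : E ≃ₗᵢ[𝕜] E') (U' : F ≃ₗᵢ[𝕜] F') :
    ∑' j, ‖U' (T (U.symm (b' j)))‖ₑ ^ 2 = ∑' i, ‖T (b i)‖ₑ ^ 2 := by
  obtain ⟨bU, hbU⟩ := exists_hilbertBasis_map_linearIsometryEquiv b U
  -- the operator `U' ∘ T ∘ U⁻¹` as a continuous linear map
  set S : E' →L[𝕜] F' := (U'.toContinuousLinearEquiv : F →L[𝕜] F') ∘L T ∘L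
    (U.symm.toContinuousLinearEquiv : E' →L[𝕜] E) with hS
  have hSapply : ∀ y : E', S y = U' (T (U.symm y)) := fun y => rfl
  calc ∑' j, ‖U' (T (U.symm (b' j)))‖ₑ ^ 2 = ∑' j, ‖S (b' j)‖ₑ ^ 2 := by simp_rw [hSapply]
    _ = ∑' i, ‖S (bU i)‖ₑ ^ 2 := tsum_enorm_sq_apply_eq_of_hilbertBasis b' bU S
    _ = ∑' i, ‖T (b i)‖ₑ ^ 2 := by
        refine tsum_congr fun i => ?_
        rw [hSapply, hbU i, U.symm_apply_apply, U'.enorm_map]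

end Unitary

/-! ### Hilbert bases and Hilbert–Schmidt sums along an orthogonal decomposition -/

/-- **Collected Hilbert basis of an orthogonal sum**: if `(V i)` is a family of pairwise
orthogonal complete subspaces of `E` with dense sum (`(⨆ i, V i)ᗮ = 0`, i.e. `E = ⊕̂ᵢ V i`) and
`(e^i_k)_k` is a Hilbert basis of `V i` for each `i`, then `(e^i_k)_{(i,k)}` is a Hilbert basis of
`E` (orthonormal by Mathlib's `OrthogonalFamily.orthonormal_sigma_orthonormal`; complete because a
vector orthogonal to every `e^i_k` has zero projection to each `V i`, by Parseval in `V i`, hence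
lies in `(⨆ i, V i)ᗮ`). Reed–Simon I, Thm. II.6 / §II.3. [cite: ReedSimon1972, Thm. II.6] -/
theorem exists_hilbertBasis_sigma {ι : Type*} {κ : ι → Type*} {V : ι → Submodule 𝕜 E}
    [∀ i, CompleteSpace (V i)]
    (hV : OrthogonalFamily 𝕜 (fun i => V i) fun i => (V i).subtypeₗᵢ)
    (hdense : (⨆ i, V i)ᗮ = ⊥) (b : ∀ i, HilbertBasis (κ i) 𝕜 (V i)) :
    ∃ B : HilbertBasis (Σ i, κ i) 𝕜 E, ∀ p, B p = (b p.1 p.2 : E) := by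
  have hon : Orthonormal 𝕜 (fun p : Σ i, κ i => ((V p.1).subtypeₗᵢ (b p.1 p.2) : E)) :=
    hV.orthonormal_sigma_orthonormal fun i => (b i).orthonormal
  refine ⟨HilbertBasis.mkOfOrthogonalEqBot hon ?_, fun p => ?_⟩
  · rw [Submodule.eq_bot_iff]
    intro x hx
    have hxi : ∀ i, x ∈ (V i)ᗮ := by
      intro i
      -- the projection of `x` to `V i` has all its coefficients zero
      have hP : ∀ k, ⟪b i k, (V i).orthogonalProjectionOnto x⟫_𝕜 = 0 := by
        intro k
        rw [Submodule.inner_orthogonalProjectionOnto_eq_of_mem_left]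
        change ⟪((V i).subtypeₗᵢ (b i k) : E), x⟫_𝕜 = 0
        have hmem : ((V i).subtypeₗᵢ (b i k) : E) ∈ Submodule.span 𝕜
            (Set.range fun p : Σ i, κ i => ((V p.1).subtypeₗᵢ (b p.1 p.2) : E)) :=
          Submodule.subset_span ⟨⟨i, k⟩, rfl⟩
        rw [inner_eq_zero_symm]
        exact Submodule.inner_left_of_mem_orthogonal hmem hx
      have h0 : (V i).orthogonalProjectionOnto x = 0 := by
        have h := tsum_enorm_inner_sq (b i) ((V i).orthogonalProjectionOnto x)
        simp only [hP, enorm_zero, ne_eq, OfNat.ofNat_ne_zero, not_false_eq_true, zero_pow,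
          tsum_zero] at h
        have h' : ‖(V i).orthogonalProjectionOnto x‖ₑ = 0 := by
          by_contra hne
          exact (pow_ne_zero 2 hne) h.symm
        exact enorm_eq_zero.mp h'
      exact (Submodule.orthogonalProjectionOnto_eq_zero_iff).mp h0
    have hx' : x ∈ (⨆ i, V i)ᗮ := by
      rw [← Submodule.iInf_orthogonal, Submodule.mem_iInf]
      exact hxi
    rwa [hdense] at hx'
  · rw [HilbertBasis.coe_mkOfOrthogonalEqBot]
    rfl

/-- **The Hilbert–Schmidt sum decomposes along an orthogonal sum of the source**
(Reed–Simon I, Thm. VI.22 (d), block form): for `E = ⊕̂ᵢ V i` as above, Hilbert bases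
`(e^i_k)_k` of the `V i`, *any* Hilbert basis `(e_l)` of `E` and any bounded `T : E → F`,
`Σ_l ‖T e_l‖² = Σ_i Σ_k ‖T e^i_k‖²` — the inner sum being the Hilbert–Schmidt sum of the block
`T|_{V i} : V i → F` (of `T|_{V i} : V i → V i` when `T` preserves `V i`). This is the step
"`tr R(f ⋆ f^*) = Σ_j tr π^j(f) π^j(f)^*` once `R = ⊕ π^j` is decomposed" of Gelbart (1975),
(10.12)–(10.14). [cite: ReedSimon1972, Thm. VI.22] [cite: Gelbart1975, (10.12)–(10.14)] -/
theorem tsum_enorm_sq_apply_eq_tsum_sigma {ι : Type*} {κ : ι → Type*} {V : ι → Submodule 𝕜 E}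
    [∀ i, CompleteSpace (V i)]
    (hV : OrthogonalFamily 𝕜 (fun i => V i) fun i => (V i).subtypeₗᵢ)
    (hdense : (⨆ i, V i)ᗮ = ⊥) (b : ∀ i, HilbertBasis (κ i) 𝕜 (V i))
    {ι₀ : Type*} (B₀ : HilbertBasis ι₀ 𝕜 E) (T : E →L[𝕜] F) :
    ∑' l, ‖T (B₀ l)‖ₑ ^ 2 = ∑' i, ∑' k, ‖T (b i k)‖ₑ ^ 2 := by
  obtain ⟨B, hB⟩ := exists_hilbertBasis_sigma hV hdense b
  rw [tsum_enorm_sq_apply_eq_of_hilbertBasis B₀ B T, ENNReal.tsum_sigma']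
  exact tsum_congr fun i => tsum_congr fun k => by rw [hB]

/-- The same with the blocks written as operators `V i → F` (`T ∘ ι_{V i}`), to which
`tsum_enorm_sq_apply_eq_of_hilbertBasis` / `tsum_enorm_sq_conj_apply_eq` apply on each block.
[cite: ReedSimon1972, Thm. VI.22] -/
theorem tsum_enorm_sq_apply_eq_tsum_sigma_comp_subtype {ι : Type*} {κ : ι → Type*}
    {V : ι → Submodule 𝕜 E} [∀ i, CompleteSpace (V i)]
    (hV : OrthogonalFamily 𝕜 (fun i => V i) fun i => (V i).subtypeₗᵢ)
    (hdense : (⨆ i, V i)ᗮ = ⊥) (b : ∀ i, HilbertBasis (κ i) 𝕜 (V i))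
    {ι₀ : Type*} (B₀ : HilbertBasis ι₀ 𝕜 E) (T : E →L[𝕜] F) :
    ∑' l, ‖T (B₀ l)‖ₑ ^ 2 = ∑' i, ∑' k, ‖(T ∘L (V i).subtypeL) (b i k)‖ₑ ^ 2 :=
  tsum_enorm_sq_apply_eq_tsum_sigma hV hdense b B₀ T

end Literature.Analysis.OperatorTheory
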